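import Literature.MathematicalPhysics.QuantumFieldTheory.Balaban1983to89.B9Eq325RKernelDecayZd
import Literature.MathematicalPhysics.QuantumFieldTheory.Balaban1983to89.B9Eq325ProjFormulaZdLevels
import Literature.MathematicalPhysics.QuantumFieldTheory.Balaban1983to89.B8Prop5Reality
import Literature.MathematicalPhysics.QuantumFieldTheory.Balaban1983to89.B8Eq138LandauZd
import Literature.MathematicalPhysics.QuantumFieldTheory.Balaban1983to89.B7Prop5Flat

/-!
# `Balaban1983to89.B9Eq326DRDsKernelDecayZd` — [Balaban1985BackgroundPropagators] (3.26) p. 395 «Δ_a = Δ + DRD* + Q*aQ», (3.63)–(3.68) pp. 404–405, Thm 3.11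
# p. 416: THE `D R(U₀) D*` LETTER OF `Δ_a(U₀)` APPLIED TO A SINGLE-BOND HERMITIAN BUMP DECAYS EXPONENTIALLY ON THE FINE LATTICE — station 4a of the Combes–Thomas
# road at the `ℤᵈ` frame (the one non-local letter of `Δ_a`; the almost-local majorant that this seat's station-5 reduction `B9Thm33GDecayOfCoerciveZd` displays),
# REDUCED TO the kernel decay of the projection `R(U₀)` on Hermitian single-site inputs, and DISCHARGED over the closed small-field class by this seat's
# station 3 (`B9Eq325RKernelDecayZd`) through dag-n06-w4's (3.25) identity `B9Eq325ProjFormulaZdLevels.projE_eq_Rop_of_herm_le` (transporters unitary up to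
# level `m` — a theorem on the class, `B9Thm311PosDefNearFlatZd.bgT_mem_unitaryUnits_of_reg17UnivP`)

statement-level skeleton of published theorems with citation tags; proofs where landed; nothing here is a claim about the
Yang–Mills mass gap

`[Balaban1985BackgroundPropagators]` ("B9", CMP **99** (1985) 389–434): (3.26) p. 395, (3.20)–(3.25) p. 394 (`R(U₀)`), (3.63)–(3.68) pp. 404–405 (locality of `R`
and of the letters built from it), Thm 3.11 p. 416; [Balaban1985RegularSpaces] (1.1) p. 76 (`D^η_{U,μ}`, `D^{η*}_{U,ν}`), (1.7) p. 77.  HERE: kinematics of the two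
range-one covariant differences around a kernel with displayed decay; crude member-dependent constants (`η⁻²`), NOT print's.

CITATION HEADER (lean-in-tree rule).  Cell `pub-ymgap` (YM Track A, HUMAN RULING D-0062 ∕ D-0149 width push), DAG node N06 = [B9], width seat
`pub-ymgap-dag-n06-w2` (g4), CLAIM-10.  Inputs BY NAME: `B8Ineq132.{covDerivFwd, covDeriv}`, `B8Eq138LandauZd.covDivB`, `B7Prop5Flat.bump`,
`B9Eq321LandauProjectionZd.{projE, projR}` (dag-n06-w4 g0), `B9Eq325ProjFormulaZd.{Rop, starSub}` (g2), `B9Eq325ProjFormulaZdLevels.projE_eq_Rop_of_herm_le` (g3∕g4),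
`B9Thm311PosDefNearFlatZd.bgT_mem_unitaryUnits_of_reg17UnivP`, `B9Thm31CoercivePrimeCompactZd.reg17Univ_of_forall_plaqF_le`, `B8Prop5Reality.isSelfAdjoint_covDeriv`,
this seat's `B9Eq325RKernelDecayZd.exists_fnorm_Rop_single_le_exp_plaqClosed`, `B9Eq342CombesThomasFormZd.{fnorm, blockAt, apply_eq_sum_blockAt, …}`,
`B9Thm31GpDecayOfCoerciveZd.fnorm_conjR_of_unitary`, `B9Eq349KernelCompositionZd.{exp_mul_exp_le_half, sum_exp_neg_mul_linfDist_le}`.  Nothing restated.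

WHAT IS PROVED (kernel, 0 sorry, 0 def).
* §1 `linfDist_add_e_le`; `bump_dir_eq_single`, `covDivB_bump_eq` (`D*` of the bump `δ_{(y′,ν)}w` is `D^{η*}_ν` of the single-site function `δ_{y′}w`),
  `fnorm_covDeriv_single_le` (`|·|_τ ≤ 2|η⁻¹|·e^{κ}·e^{−κ|x−y′|_∞}·|w|_τ`), `isSelfAdjoint_covDivB_bump` (Hermitian for Hermitian `w`, unitary `U₀`).
* §2 `fnorm_apply_le_sum_of_blockDecay_on` (H §4 with the block hypothesis only at the values met), `starSub_restrictSite_single` (a Hermitian single-site input is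
  `*`-fixed), ★ `fnorm_projR_le_of_decay` (`R(U₀)` of a Hermitian field decaying from `y′` decays from `y′` at half the rate, given the displayed decay of the blocks
  `R(U₀)δ_y v`, `v` Hermitian), `fnorm_covDerivFwd_le_of_decay`.
* §3 ★★★ `fnorm_DRD_bump_le_of_projE_decay` — THE REDUCTION: displayed decay `|(R(U₀)δ_y v)(x)|_τ ≤ C_P e^{−κ_P|x−y|_∞}|v|_τ` (`y ∈ Ω₀`, `v` Hermitian, `κ_P > 0`)
  ⟹ `|(D^η_{U₀,μ} R(U₀) 𝟙_{Ω₀} D^{η*}_{U₀} δ_{(y′,ν)}w)(x)|_τ ≤ 2|η⁻¹|²e^{κ_P}(e^{κ_P∕2}+1)·C_P·K_d(κ_P∕2)·e^{−(κ_P∕2)|x−y′|_∞}·|w|_τ` for Hermitian `w`, unitary `U₀`.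
* §4 ★★★ `exists_fnorm_DRD_bump_le_exp_plaqClosed` — THE DISCHARGE over the closed small-field class `‖U₀(∂p) − 1‖ ≤ β`, `β < (α_Q∕L²)L^{−2m}`, `Q′*` injective (print's
  «Q′ onto» — the one displayed input): ONE `(C_D, κ_D)` with `|(D R(U₀) 𝟙_{Ω₀} D* δ_{(y′,ν)}w)(x, μ)|_τ ≤ C_D·e^{−κ_D|x−y′|_∞}·|w|_τ` for EVERY unitary `U₀` of the class
  (its averaged transporters are unitary up to level `m` by [Balaban1985Averaging] Prop. 2 — dag-n06-b's `bgT_mem_unitaryUnits_of_reg17UnivP`).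

HONEST SCOPE.  Count-neutral helper; one of the four letters of `Δ_a` (the other three — `D*D`, `Δ′`, `Q*aQ` — are finite-range ∕ block-local and not treated here);
crude member-dependent constants; N05 ∕ N06 NOT discharged; K1⁹ `stmt-QuantumFields-27364`
NOT closed; one finite `𝕋⁴` programme at fixed `ε`, Bałaban as printed; R4 closes only the conditional finite-`𝕋⁴` rung `BalabanLadder.UV` — nothing continuum ∕ ℝ⁴ ∕
OS ∕ mass gap ∕ Clay.  Unit `pub-ymgap-dag-n06-w2` (g4), 2026-08-28.
-/

noncomputable section

open scoped BigOperators Nat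

namespace Literature.MathematicalPhysics.QuantumFieldTheory.Balaban1983to89.B9Eq326DRDsKernelDecayZd

open B7Eq78Linearization (conjR conjR_apply)
open B7Prop1Explicit (e)
open B7Prop2Explicit (unitaryUnits)
open B7Prop5Flat (bump)
open B8Eq119TwistedAxial (bgT)
open B8Ineq132 (covDeriv covDerivFwd plaqF)
open B8Eq138LandauZd (covDivB)
open B9Eq321LandauProjectionZd (suppSub projE projR)
open B9Eq324DeltaPrimeAZd (single restrictSite restrictSite_coe)
open B9Eq325QGGQInvZd (QprimeStarInjective)
open B9Eq325ProjFormulaZd (Rop starSub coe_starSub starFun_apply)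
open B9Eq325ProjFormulaZdLevels (projE_eq_Rop_of_herm_le)
open B9Eq316AveragingTransposeZd (alphaQ)
open B9Eq342CombesThomasFormZd (fnorm fnorm_nonneg fnorm_zero fnorm_smul fnorm_add_le fnorm_sum_le blockAt blockAt_def apply_eq_sum_blockAt
  single_apply_self single_apply_of_ne restrictSite_single_coe)
open B9Thm31GpDecayOfCoerciveZd (fnorm_conjR_of_unitary)
open B9Eq349KernelCompositionZd (exp_mul_exp_le_half sum_exp_neg_mul_linfDist_le)
open B9Eq325RKernelDecayZd (exists_fnorm_Rop_single_le_exp_plaqClosed)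
open LatticeNorms (linfDist)

export B7Prop1Explicit (Site)

variable {d : ℕ} {𝔸 : Type*} [CStarAlgebra 𝔸]

/-! ## §1  `D*` of a single-bond bump -/

section DStar

/-- a unit step moves `ℓ^∞`-distance at most `1`: `|x + e_μ − x|_∞ ≤ 1`. [cite: Balaban1985RegularSpaces, (1.1) p.76 (bookkeeping)] -/
theorem linfDist_add_e_le (x : Site d) (μ : Fin d) : linfDist (x + e μ) x ≤ 1 := by
  rw [LatticeNorms.linfDist_le_iff]
  intro i
  simp only [Pi.add_apply, e, Pi.single_apply]
  split_ifs <;> simp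

/-- `|f(a) − f(b)|`-bookkeeping: `fnorm τ (a − b) ≤ fnorm τ a + fnorm τ b`. [cite: Balaban1985BackgroundPropagators, (3.21) p.394 (bookkeeping)] -/
theorem fnorm_sub_le (τ : 𝔸 →ₗ[ℂ] ℂ) (hτp : ∀ a : 𝔸, a ≠ 0 → 0 < (τ (star a * a)).re) (hτs : ∀ a : 𝔸, τ (star a) = starRingEnd ℂ (τ a)) (a b : 𝔸) :
    fnorm τ (a - b) ≤ fnorm τ a + fnorm τ b := by
  rw [sub_eq_add_neg]
  refine (fnorm_add_le hτp hτs a _).trans (le_of_eq ?_)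
  rw [← neg_one_smul ℝ b, fnorm_smul]; simp

/-- the `ν`-component of the bump `δ_{(y′,ν)}w` is the single-site function `δ_{y′}w`; the other components vanish.
[cite: Balaban1985RegularSpaces, p.77 (bond convention; bookkeeping)] -/
theorem bump_dir_eq (y' : Site d) (ν μ : Fin d) (w : 𝔸) : (fun z => bump y' ν w z μ) = if μ = ν then single y' w else 0 := by
  funext z
  by_cases h : μ = ν
  · subst h; rw [if_pos rfl]; simp [bump, single]
  · rw [if_neg h, Pi.zero_apply]; simp [bump, h]

/-- `D^{η*}_{U₀,μ}` of the zero function vanishes. [cite: Balaban1985RegularSpaces, (1.1) p.76 (bookkeeping)] -/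
theorem covDeriv_zero (η : ℝ) (U₀ : Site d → Fin d → 𝔸ˣ) (μ : Fin d) (x : Site d) : covDeriv η U₀ μ (0 : Site d → 𝔸) x = 0 := by
  simp [covDeriv, conjR_apply]

/-- **`D*` OF THE BUMP IS `D^{η*}_ν` OF THE SINGLE-SITE FUNCTION**: `(D^{η*}_{U₀}δ_{(y′,ν)}w)(x) = (D^{η*}_{U₀,ν}δ_{y′}w)(x)`.
[cite: Balaban1985BackgroundPropagators, (3.23) p.394; Balaban1985RegularSpaces, (1.1) p.76] -/
theorem covDivB_bump_eq (η : ℝ) (U₀ : Site d → Fin d → 𝔸ˣ) (y' : Site d) (ν : Fin d) (w : 𝔸) (x : Site d) :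
    covDivB η U₀ (bump y' ν w) x = covDeriv η U₀ ν (single y' w) x := by
  classical
  rw [covDivB, Finset.sum_eq_single ν]
  · rw [bump_dir_eq, if_pos rfl]
  · intro μ _ hμ
    rw [bump_dir_eq, if_neg hμ, covDeriv_zero]
  · intro h; exact absurd (Finset.mem_univ ν) h

/-- **THE SIZE AND RANGE OF `D^{η*}_ν δ_{y′}w`**: `|(D^{η*}_{U₀,ν}δ_{y′}w)(x)|_τ ≤ 2|η⁻¹|·e^{κ}·e^{−κ|x−y′|_∞}·|w|_τ` (`κ ≥ 0`, unitary `U₀`, tracial `τ`) — it lives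
on `{y′, y′ + e_ν}`. [cite: Balaban1985RegularSpaces, (1.1) p.76; Balaban1985BackgroundPropagators, (3.63)–(3.68) pp.404–405] -/
theorem fnorm_covDeriv_single_le (τ : 𝔸 →ₗ[ℂ] ℂ) (hτp : ∀ a : 𝔸, a ≠ 0 → 0 < (τ (star a * a)).re) (hτt : ∀ a b : 𝔸, τ (a * b) = τ (b * a))
    (hτs : ∀ a : 𝔸, τ (star a) = starRingEnd ℂ (τ a)) (η : ℝ) {U₀ : Site d → Fin d → 𝔸ˣ} (hU : ∀ (x : Site d) (κ : Fin d), U₀ x κ ∈ unitaryUnits 𝔸)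
    (y' : Site d) (ν : Fin d) (w : 𝔸) {κ : ℝ} (hκ : 0 ≤ κ) (x : Site d) :
    fnorm τ (covDeriv η U₀ ν (single y' w) x) ≤ 2 * |η⁻¹| * Real.exp κ * Real.exp (-(κ * (linfDist x y' : ℝ))) * fnorm τ w := by
  rw [covDeriv, fnorm_smul]
  have hw0 := fnorm_nonneg τ w
  have h1 : fnorm τ (conjR (U₀ (x - e ν) ν)⁻¹ (single y' w (x - e ν))) ≤ (if x - e ν = y' then 1 else 0) * fnorm τ w := by
    rw [fnorm_conjR_of_unitary τ hτt ((unitaryUnits 𝔸).inv_mem (hU _ ν))]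
    by_cases h : x - e ν = y'
    · rw [if_pos h, h, single_apply_self, one_mul]
    · rw [if_neg h, single_apply_of_ne h, fnorm_zero, zero_mul]
  have h2 : fnorm τ (single y' w x) ≤ (if x = y' then 1 else 0) * fnorm τ w := by
    by_cases h : x = y'
    · rw [h, single_apply_self, if_pos rfl, one_mul]
    · rw [single_apply_of_ne h, fnorm_zero, if_neg h, zero_mul]
  have hsum := (fnorm_sub_le τ hτp hτs _ _).trans (add_le_add h1 h2)
  refine (mul_le_mul_of_nonneg_left hsum (abs_nonneg _)).trans ?_
  -- each indicator is `≤ e^{κ}·e^{−κ|x−y′|}` since the support is within distance `1` of `y′`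
  have hE : ∀ (P : Prop) [Decidable P], (P → linfDist x y' ≤ 1) → (if P then (1 : ℝ) else 0) ≤ Real.exp κ * Real.exp (-(κ * (linfDist x y' : ℝ))) := by
    intro P _ hP
    split_ifs with h
    · have hd : (linfDist x y' : ℝ) ≤ 1 := by exact_mod_cast hP h
      rw [← Real.exp_add]
      have : (0 : ℝ) ≤ κ + -(κ * (linfDist x y' : ℝ)) := by nlinarith
      exact Real.one_le_exp_iff.mpr this
    · positivity
  have hA := hE (x - e ν = y') (fun h => by
    have hx : x = y' + e ν := by rw [← h]; abel
    rw [hx]; exact linfDist_add_e_le y' ν)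
  have hB := hE (x = y') (fun h => by rw [h, LatticeNorms.linfDist_self]; exact zero_le_one)
  calc |η⁻¹| * ((if x - e ν = y' then (1 : ℝ) else 0) * fnorm τ w + (if x = y' then (1 : ℝ) else 0) * fnorm τ w)
      = |η⁻¹| * fnorm τ w * ((if x - e ν = y' then (1 : ℝ) else 0) + (if x = y' then (1 : ℝ) else 0)) := by ring
    _ ≤ |η⁻¹| * fnorm τ w * (Real.exp κ * Real.exp (-(κ * (linfDist x y' : ℝ))) + Real.exp κ * Real.exp (-(κ * (linfDist x y' : ℝ)))) :=
        mul_le_mul_of_nonneg_left (add_le_add hA hB) (mul_nonneg (abs_nonneg _) hw0)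
    _ = 2 * |η⁻¹| * Real.exp κ * Real.exp (-(κ * (linfDist x y' : ℝ))) * fnorm τ w := by ring

/-- `D*` of a Hermitian bump is Hermitian (unitary `U₀`). [cite: Balaban1985BackgroundPropagators, (3.21) p.394 («L²(Ω₀, 𝔤)»); Balaban1985RegularSpaces, (1.1) p.76] -/
theorem isSelfAdjoint_covDivB_bump (η : ℝ) {U₀ : Site d → Fin d → 𝔸ˣ} (hU : ∀ (x : Site d) (κ : Fin d), U₀ x κ ∈ unitaryUnits 𝔸) (y' : Site d) (ν : Fin d)
    {w : 𝔸} (hw : IsSelfAdjoint w) (x : Site d) : IsSelfAdjoint (covDivB η U₀ (bump y' ν w) x) := by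
  rw [covDivB_bump_eq]
  refine B8Prop5Reality.isSelfAdjoint_covDeriv hU (fun z => ?_) ν x
  by_cases h : z = y'
  · rw [h, single_apply_self]; exact hw
  · rw [single_apply_of_ne h]; exact IsSelfAdjoint.zero 𝔸

end DStar

/-! ## §2  `R(U₀)` of a decaying Hermitian field; `D` of a decaying field -/

section Proj

variable (τ : 𝔸 →ₗ[ℂ] ℂ) {s : Finset (Site d)}

/-- H §4 with the block hypothesis only at the values the field takes: `|(Gf)(x)|_τ ≤ Σ_{x′∈s} C e^{−κ|x−x′|_∞}|f(x′)|_τ`.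
[cite: Balaban1985BackgroundPropagators, (3.42) p.397, (3.107)–(3.108) pp.415–416] -/
theorem fnorm_apply_le_sum_of_blockDecay_on (hτp : ∀ a : 𝔸, a ≠ 0 → 0 < (τ (star a * a)).re) (hτs : ∀ a : 𝔸, τ (star a) = starRingEnd ℂ (τ a))
    (G : suppSub (𝔸 := 𝔸) s →ₗ[ℝ] suppSub (𝔸 := 𝔸) s) {C κ : ℝ} (f : suppSub (𝔸 := 𝔸) s)
    (hG : ∀ x' ∈ s, ∀ x : Site d, fnorm τ (blockAt s G x' ((f : Site d → 𝔸) x') x) ≤ C * Real.exp (-(κ * (linfDist x x' : ℝ))) * fnorm τ ((f : Site d → 𝔸) x'))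
    (x : Site d) :
    fnorm τ ((G f : Site d → 𝔸) x) ≤ ∑ x' ∈ s, C * Real.exp (-(κ * (linfDist x x' : ℝ))) * fnorm τ ((f : Site d → 𝔸) x') := by
  rw [apply_eq_sum_blockAt]
  exact (fnorm_sum_le hτp hτs _ _).trans (Finset.sum_le_sum fun x' hx' => hG x' hx' x)

/-- a Hermitian single-site input is `*`-fixed: `(δ_y v)* = δ_y v` for `v* = v`. [cite: Balaban1985BackgroundPropagators, (3.21) p.394 (bookkeeping)] -/
theorem starSub_restrictSite_single {y : Site d} (hy : y ∈ s) {v : 𝔸} (hv : IsSelfAdjoint v) :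
    starSub (restrictSite s (single y v)) = restrictSite s (single y v) := by
  apply Subtype.ext
  rw [coe_starSub, restrictSite_single_coe hy]
  funext x
  rw [starFun_apply]
  by_cases h : x = y
  · rw [h, single_apply_self]; exact hv.star_eq
  · rw [single_apply_of_ne h, star_zero]

variable (s) (L m : ℕ) (η : ℝ) (Λs : ℕ → Set (Site d)) (U₀ : Site d → Fin d → 𝔸ˣ)

/-- ★ **`R(U₀)` OF A HERMITIAN FIELD DECAYING FROM `y′` DECAYS FROM `y′`**: if the blocks `R(U₀)δ_y v` (`y ∈ Ω₀`, `v` Hermitian) obey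
`|·(x)|_τ ≤ C_P e^{−κ_P|x−y|_∞}|v|_τ` (`C_P ≥ 0`, `κ_P > 0`) and `f` is Hermitian on `Ω₀` with `|f(z)|_τ ≤ B e^{−κ_P|z−y′|_∞}` there, then
`|(R(U₀)𝟙_{Ω₀}f)(x)|_τ ≤ C_P·B·K_d(κ_P∕2)·e^{−(κ_P∕2)|x−y′|_∞}`. [cite: Balaban1985BackgroundPropagators, (3.21)–(3.25) p.394, (3.63)–(3.68) pp.404–405] -/
theorem fnorm_projR_le_of_decay (hτp : ∀ a : 𝔸, a ≠ 0 → 0 < (τ (star a * a)).re) (hτs : ∀ a : 𝔸, τ (star a) = starRingEnd ℂ (τ a)) {CP κP : ℝ}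
    (hCP : 0 ≤ CP) (hκP : 0 < κP)
    (hP : ∀ y ∈ s, ∀ v : 𝔸, IsSelfAdjoint v → ∀ x : Site d,
      fnorm τ ((projE τ s L m η Λs U₀ (restrictSite s (single y v)) : Site d → 𝔸) x) ≤ CP * Real.exp (-(κP * (linfDist x y : ℝ))) * fnorm τ v)
    {f : Site d → 𝔸} (hf : ∀ z ∈ s, IsSelfAdjoint (f z)) {B : ℝ} (hB : 0 ≤ B) (y' : Site d)
    (hfb : ∀ z ∈ s, fnorm τ (f z) ≤ B * Real.exp (-(κP * (linfDist z y' : ℝ)))) (x : Site d) :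
    fnorm τ (projR τ s L m η Λs U₀ f x) ≤
      CP * B * ((3 : ℝ) ^ d * (d ! : ℝ) * (2 / (κP / 2)) ^ d * Real.exp (κP / 2 / 2) / (1 - Real.exp (-(κP / 2 / 2)))) *
        Real.exp (-(κP / 2 * (linfDist x y' : ℝ))) := by
  have hR : projR τ s L m η Λs U₀ f x = (projE τ s L m η Λs U₀ (restrictSite s f) : Site d → 𝔸) x := rfl
  rw [hR]
  have hcoe : ∀ z ∈ s, ((restrictSite s f : suppSub (𝔸 := 𝔸) s) : Site d → 𝔸) z = f z :=
    fun z hz => by rw [restrictSite_coe, Set.indicator_of_mem (Finset.mem_coe.mpr hz)]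
  have hblk : ∀ x' ∈ s, ∀ x : Site d, fnorm τ (blockAt s (projE τ s L m η Λs U₀) x' (((restrictSite s f : suppSub (𝔸 := 𝔸) s) : Site d → 𝔸) x') x) ≤
      CP * Real.exp (-(κP * (linfDist x x' : ℝ))) * fnorm τ (((restrictSite s f : suppSub (𝔸 := 𝔸) s) : Site d → 𝔸) x') := by
    intro x' hx' x
    rw [hcoe x' hx', blockAt_def]
    exact hP x' hx' (f x') (hf x' hx') x
  refine (fnorm_apply_le_sum_of_blockDecay_on τ hτp hτs (projE τ s L m η Λs U₀) (restrictSite s f) hblk x).trans ?_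
  have hdist0 : ∀ a b : Site d, (0 : ℝ) ≤ (linfDist a b : ℝ) := fun a b => Nat.cast_nonneg _
  have hdt : ∀ a b c : Site d, (linfDist a c : ℝ) ≤ (linfDist a b : ℝ) + (linfDist b c : ℝ) :=
    fun a b c => by exact_mod_cast LatticeNorms.linfDist_triangle a b c
  have hterm : ∀ x' ∈ s, CP * Real.exp (-(κP * (linfDist x x' : ℝ))) * fnorm τ (((restrictSite s f : suppSub (𝔸 := 𝔸) s) : Site d → 𝔸) x') ≤
      CP * B * (Real.exp (-(κP / 2 * (linfDist x y' : ℝ))) * Real.exp (-(κP / 2 * (linfDist x x' : ℝ)))) := by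
    intro x' hx'
    rw [hcoe x' hx']
    calc CP * Real.exp (-(κP * (linfDist x x' : ℝ))) * fnorm τ (f x')
        ≤ CP * Real.exp (-(κP * (linfDist x x' : ℝ))) * (B * Real.exp (-(κP * (linfDist x' y' : ℝ)))) :=
          mul_le_mul_of_nonneg_left (hfb x' hx') (by positivity)
      _ = CP * B * (Real.exp (-(κP * (linfDist x x' : ℝ))) * Real.exp (-(κP * (linfDist x' y' : ℝ)))) := by ring
      _ ≤ CP * B * (Real.exp (-(κP / 2 * (linfDist x y' : ℝ))) * Real.exp (-(κP / 2 * (linfDist x x' : ℝ)))) :=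
          mul_le_mul_of_nonneg_left (exp_mul_exp_le_half hdist0 hdt hκP.le x x' y') (mul_nonneg hCP hB)
  refine (Finset.sum_le_sum hterm).trans ?_
  rw [← Finset.mul_sum, ← Finset.mul_sum]
  have h2 := sum_exp_neg_mul_linfDist_le (d := d) (half_pos hκP) s x
  calc CP * B * (Real.exp (-(κP / 2 * (linfDist x y' : ℝ))) * ∑ x' ∈ s, Real.exp (-(κP / 2 * (linfDist x x' : ℝ))))
      ≤ CP * B * (Real.exp (-(κP / 2 * (linfDist x y' : ℝ))) *
          ((3 : ℝ) ^ d * (d ! : ℝ) * (2 / (κP / 2)) ^ d * Real.exp (κP / 2 / 2) / (1 - Real.exp (-(κP / 2 / 2))))) :=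
        mul_le_mul_of_nonneg_left (mul_le_mul_of_nonneg_left h2 (Real.exp_pos _).le) (mul_nonneg hCP hB)
    _ = _ := by ring

/-- **`D` OF A DECAYING FIELD**: `|(D^η_{U₀,μ}g)(x)|_τ ≤ |η⁻¹|·B·(e^{ν} + 1)·e^{−ν|x−y′|_∞}` if `|g(z)|_τ ≤ B e^{−ν|z−y′|_∞}` everywhere (`ν ≥ 0`, unitary `U₀`, tracial `τ`).
[cite: Balaban1985RegularSpaces, (1.1) p.76; Balaban1985BackgroundPropagators, (3.63)–(3.68) pp.404–405] -/
theorem fnorm_covDerivFwd_le_of_decay (hτp : ∀ a : 𝔸, a ≠ 0 → 0 < (τ (star a * a)).re) (hτt : ∀ a b : 𝔸, τ (a * b) = τ (b * a))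
    (hτs : ∀ a : 𝔸, τ (star a) = starRingEnd ℂ (τ a)) (hU : ∀ (x : Site d) (κ : Fin d), U₀ x κ ∈ unitaryUnits 𝔸) {g : Site d → 𝔸} {B ν : ℝ}
    (hB : 0 ≤ B) (hν : 0 ≤ ν) (y' : Site d) (hg : ∀ z, fnorm τ (g z) ≤ B * Real.exp (-(ν * (linfDist z y' : ℝ)))) (μ : Fin d) (x : Site d) :
    fnorm τ (covDerivFwd η U₀ μ g x) ≤ |η⁻¹| * B * (Real.exp ν + 1) * Real.exp (-(ν * (linfDist x y' : ℝ))) := by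
  rw [covDerivFwd, fnorm_smul]
  have h1 : fnorm τ (conjR (U₀ x μ) (g (x + e μ))) ≤ B * (Real.exp ν * Real.exp (-(ν * (linfDist x y' : ℝ)))) := by
    rw [fnorm_conjR_of_unitary τ hτt (hU x μ)]
    refine (hg (x + e μ)).trans (mul_le_mul_of_nonneg_left ?_ hB)
    rw [← Real.exp_add, Real.exp_le_exp]
    have t := LatticeNorms.linfDist_triangle x (x + e μ) y'
    have h1 := linfDist_add_e_le x μ
    rw [LatticeNorms.linfDist_comm] at h1
    have hcast : (linfDist x y' : ℝ) ≤ 1 + (linfDist (x + e μ) y' : ℝ) := by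
      have : linfDist x y' ≤ 1 + linfDist (x + e μ) y' := by omega
      exact_mod_cast this
    nlinarith
  have h2 := hg x
  have hsum := (fnorm_sub_le τ hτp hτs _ _).trans (add_le_add h1 h2)
  refine (mul_le_mul_of_nonneg_left hsum (abs_nonneg _)).trans (le_of_eq ?_)
  ring

end Proj

/-! ## §3  ★★★ The reduction: the `D R(U₀) D*` letter of a Hermitian bump, given the decay of `R(U₀)` on Hermitian single-site inputs -/

section Reduction

variable (τ : 𝔸 →ₗ[ℂ] ℂ) (s : Finset (Site d)) (L m : ℕ) (η : ℝ) (Λs : ℕ → Set (Site d)) (U₀ : Site d → Fin d → 𝔸ˣ)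

/-- ★★★ **THE `D R(U₀) 𝟙_{Ω₀} D*` LETTER OF A HERMITIAN SINGLE-BOND BUMP DECAYS, GIVEN THE DECAY OF `R(U₀)` ON HERMITIAN SINGLE-SITE INPUTS.**  Unitary `U₀`,
faithful Hermitian tracial `τ`, Hermitian `w`; displayed: `|(R(U₀)δ_y v)(x)|_τ ≤ C_P·e^{−κ_P|x−y|_∞}·|v|_τ` for `y ∈ Ω₀`, `v` Hermitian (`C_P ≥ 0`, `κ_P > 0`).  Then for every
bond `(y′, ν)`, direction `μ`, site `x`:
`|(D^η_{U₀,μ} R(U₀) 𝟙_{Ω₀} D^{η*}_{U₀} δ_{(y′,ν)}w)(x)|_τ ≤ |η⁻¹|·(C_P·(2|η⁻¹|e^{κ_P})·K_d(κ_P∕2))·(e^{κ_P∕2}+1)·e^{−(κ_P∕2)|x−y′|_∞}·|w|_τ`.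
[cite: Balaban1985BackgroundPropagators, (3.26) p.395, (3.20)–(3.25) p.394, (3.63)–(3.68) pp.404–405; Balaban1985RegularSpaces, (1.1) p.76] -/
theorem fnorm_DRD_bump_le_of_projE_decay (hτp : ∀ a : 𝔸, a ≠ 0 → 0 < (τ (star a * a)).re) (hτt : ∀ a b : 𝔸, τ (a * b) = τ (b * a))
    (hτs : ∀ a : 𝔸, τ (star a) = starRingEnd ℂ (τ a)) (hU : ∀ (x : Site d) (κ : Fin d), U₀ x κ ∈ unitaryUnits 𝔸) {CP κP : ℝ} (hCP : 0 ≤ CP)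
    (hκP : 0 < κP)
    (hP : ∀ y ∈ s, ∀ v : 𝔸, IsSelfAdjoint v → ∀ x : Site d,
      fnorm τ ((projE τ s L m η Λs U₀ (restrictSite s (single y v)) : Site d → 𝔸) x) ≤ CP * Real.exp (-(κP * (linfDist x y : ℝ))) * fnorm τ v)
    {w : 𝔸} (hw : IsSelfAdjoint w) (y' : Site d) (ν μ : Fin d) (x : Site d) :
    fnorm τ (covDerivFwd η U₀ μ (projR τ s L m η Λs U₀ (covDivB η U₀ (bump y' ν w))) x) ≤
      |η⁻¹| * (CP * (2 * |η⁻¹| * Real.exp κP * fnorm τ w) *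
          ((3 : ℝ) ^ d * (d ! : ℝ) * (2 / (κP / 2)) ^ d * Real.exp (κP / 2 / 2) / (1 - Real.exp (-(κP / 2 / 2))))) *
        (Real.exp (κP / 2) + 1) * Real.exp (-(κP / 2 * (linfDist x y' : ℝ))) := by
  -- `D*` of the bump: Hermitian, size `2|η⁻¹||w|`, within distance `1` of `y′`
  have hf : ∀ z ∈ s, IsSelfAdjoint (covDivB η U₀ (bump y' ν w) z) := fun z _ => isSelfAdjoint_covDivB_bump η hU y' ν hw z
  have hfb : ∀ z ∈ s, fnorm τ (covDivB η U₀ (bump y' ν w) z) ≤ 2 * |η⁻¹| * Real.exp κP * fnorm τ w * Real.exp (-(κP * (linfDist z y' : ℝ))) := by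
    intro z _
    rw [covDivB_bump_eq]
    have h := fnorm_covDeriv_single_le τ hτp hτt hτs η hU y' ν w hκP.le z
    linarith [h]
  have hB : 0 ≤ 2 * |η⁻¹| * Real.exp κP * fnorm τ w := by have := fnorm_nonneg τ w; positivity
  -- `R(U₀)` of it
  have hg := fnorm_projR_le_of_decay τ s L m η Λs U₀ hτp hτs hCP hκP hP hf hB y' hfb
  -- `D` of that
  have hK0 : 0 ≤ CP * (2 * |η⁻¹| * Real.exp κP * fnorm τ w) *
      ((3 : ℝ) ^ d * (d ! : ℝ) * (2 / (κP / 2)) ^ d * Real.exp (κP / 2 / 2) / (1 - Real.exp (-(κP / 2 / 2)))) := by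
    have h := sum_exp_neg_mul_linfDist_le (d := d) (half_pos hκP) ∅ (0 : Site d)
    rw [Finset.sum_empty] at h
    exact mul_nonneg (mul_nonneg hCP hB) h
  exact fnorm_covDerivFwd_le_of_decay τ η U₀ hτp hτt hτs hU hK0 (half_pos hκP).le y' hg μ x

end Reduction

/-! ## §4  ★★★ The discharge over the closed small-field class -/

section PlaqClosed

variable (L : ℕ) (η : ℝ) (τ : 𝔸 →ₗ[ℂ] ℂ) [FiniteDimensional ℝ 𝔸] [Nontrivial 𝔸]
  (hτp : ∀ a : 𝔸, a ≠ 0 → 0 < (τ (star a * a)).re) (hτt : ∀ a b : 𝔸, τ (a * b) = τ (b * a)) (hτs : ∀ a : 𝔸, τ (star a) = starRingEnd ℂ (τ a))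
  (m : ℕ) (a : ℕ → ℝ) (Λ : ℕ → Finset (Site d)) (s : Finset (Site d))

include hτt hτs a in
/-- ★★★ **STATION 4a: THE `D R(U₀) 𝟙_{Ω₀} D*` LETTER OF `Δ_a(U₀)` ON HERMITIAN SINGLE-BOND BUMPS DECAYS, UNIFORMLY OVER THE CLOSED SMALL-FIELD CLASS.**
`0 < d`, `2 ≤ L`, `η ≠ 0`, weights `a ≥ 0` (only through the (3.25) identity — `R` does not depend on them), finite `Ω₀ = s`, faithful Hermitian tracial `τ` on a
finite-dimensional nontrivial fibre, `β < (α_Q∕L²)·L^{−2m}`, `Q′*` injective on the class.  Then there are `C_D > 0`, `κ_D > 0` such that for EVERY unitary `U₀` with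
`‖U₀(∂p) − 1‖ ≤ β`, every bond `(y′,ν)`, direction `μ`, site `x`, Hermitian `w`:  `|(D^η_{U₀,μ} R(U₀) 𝟙_{Ω₀} D^{η*}_{U₀} δ_{(y′,ν)}w)(x)|_τ ≤ C_D·e^{−κ_D|x−y′|_∞}·|w|_τ`
(the averaged transporters of such `U₀` are unitary up to level `m` by the regime (1.7), which is all the (3.25) identity reads).
[cite: Balaban1985BackgroundPropagators, (3.26) p.395, (3.25) p.394, (3.63)–(3.68) pp.404–405, Thm 3.11 p.416; Balaban1985RegularSpaces, (1.1) p.76, (1.7) p.77; Balaban1985Averaging, Prop. 2 p.26] -/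
theorem exists_fnorm_DRD_bump_le_exp_plaqClosed (hd : 0 < d) (hL : 2 ≤ L) (hη : η ≠ 0) (ha : ∀ j, 0 ≤ a j) {β : ℝ}
    (hβ : β < alphaQ d L / (L : ℝ) ^ 2 * (((L : ℝ) ^ m)⁻¹) ^ 2)
    (hinj : ∀ U₀ : Site d → Fin d → 𝔸ˣ, (∀ x κ, U₀ x κ ∈ unitaryUnits 𝔸) → QprimeStarInjective L U₀ τ hτp m Λ s) :
    ∃ CD : ℝ, 0 < CD ∧ ∃ κD : ℝ, 0 < κD ∧ ∀ (U₀ : Site d → Fin d → 𝔸ˣ) (hU : ∀ x κ', U₀ x κ' ∈ unitaryUnits 𝔸),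
      (∀ (x : Site d) (μ ν : Fin d), ‖plaqF U₀ μ ν x - 1‖ ≤ β) →
        ∀ (y' : Site d) (ν μ : Fin d) (x : Site d) (w : 𝔸), IsSelfAdjoint w →
          fnorm τ (covDerivFwd η U₀ μ (projR τ s L m η (fun j => (↑(Λ j) : Set (Site d))) U₀ (covDivB η U₀ (bump y' ν w))) x) ≤
            CD * Real.exp (-(κD * (linfDist x y' : ℝ))) * fnorm τ w := by
  obtain ⟨CR, hCR, κR, hκR, hRdec⟩ := exists_fnorm_Rop_single_le_exp_plaqClosed L η τ hτp hτt hτs m a Λ s hd hL hη ha hβ hinj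
  obtain ⟨K2, hK2⟩ : ∃ K : ℝ, K = (3 : ℝ) ^ d * (d ! : ℝ) * (2 / (κR / 2)) ^ d * Real.exp (κR / 2 / 2) / (1 - Real.exp (-(κR / 2 / 2))) := ⟨_, rfl⟩
  have hK20 : 0 < K2 := by
    have hden : 0 < 1 - Real.exp (-(κR / 2 / 2)) := by
      have : Real.exp (-(κR / 2 / 2)) < 1 := Real.exp_lt_one_iff.mpr (by linarith)
      linarith
    rw [hK2]; positivity
  set CD : ℝ := |η⁻¹| * (CR * (2 * |η⁻¹| * Real.exp κR) * K2) * (Real.exp (κR / 2) + 1) with hCD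
  have hη' : 0 < |η⁻¹| := abs_pos.mpr (inv_ne_zero hη)
  have hCD0 : 0 < CD := by rw [hCD]; positivity
  refine ⟨CD, hCD0, κR / 2, half_pos hκR, fun U₀ hU hplaq y' ν μ x w hw => ?_⟩
  have hL1 : 1 ≤ L := le_trans one_le_two hL
  have hreg := B9Thm31CoercivePrimeCompactZd.reg17Univ_of_forall_plaqF_le (𝔸 := 𝔸) hL1 m hβ hplaq
  have hT : ∀ j, j ≤ m → ∀ (z y : Site d), bgT L U₀ j z y ∈ unitaryUnits 𝔸 :=
    B9Thm311PosDefNearFlatZd.bgT_mem_unitaryUnits_of_reg17UnivP hd hL m hU hreg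
  -- the displayed decay of `R(U₀)` on Hermitian single-site inputs, from station 3 via (3.25)
  have hP : ∀ y ∈ s, ∀ v : 𝔸, IsSelfAdjoint v → ∀ x : Site d,
      fnorm τ ((projE τ s L m η (fun j => (↑(Λ j) : Set (Site d))) U₀ (restrictSite s (single y v)) : Site d → 𝔸) x) ≤
        CR * Real.exp (-(κR * (linfDist x y : ℝ))) * fnorm τ v := by
    intro y hy v hv x
    rw [projE_eq_Rop_of_herm_le L U₀ η τ hτp m a Λ s hd hη hτt hτs hU ha (hinj U₀ hU) hT (starSub_restrictSite_single hy hv)]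
    exact hRdec U₀ hU hplaq y hy v x
  have key := fnorm_DRD_bump_le_of_projE_decay τ s L m η (fun j => (↑(Λ j) : Set (Site d))) U₀ hτp hτt hτs hU hCR.le hκR hP hw y' ν μ x
  refine key.trans (le_of_eq ?_)
  rw [hCD, hK2]; ring

end PlaqClosed

end Literature.MathematicalPhysics.QuantumFieldTheory.Balaban1983to89.B9Eq326DRDsKernelDecayZd

end
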